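import Literature.RepresentationTheory.FiniteGroups.PermutationReductionSigmaAndPoint
import Literature.RepresentationTheory.FiniteGroups.ArtinGassmannPermutationSets
import HarnessLib

/-!
# Reduction mod `p` of the permutation lattice of a FREE `G`-set: `ψ(ℤ[X]/p) = n • ψ(ℤ[G]/p)`
# for a free finite `G`-set `X` with `n` orbits

Topic `RepresentationTheory/FiniteGroups`; namespace `Literature.RepresentationTheory.FiniteGroups`
(sub-namespace `PermutationLattice`, continued).  THEOREMS ONLY (no definition, no named fact, no
`sorry`, no instance).  Sequel of `PermutationReductionSigmaAndPoint` (finite disjoint unions),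
`PermutationLatticeReduction` (`ℚ[X] ≅ ℚ[Y] ⟹ ψ(ℤ[X]/p) = ψ(ℤ[Y]/p)`), `ArtinGassmannPermutationSets`
(fixed points on `Σ i, X i`) and the tree's `GassmannEquivalentPermutationModules` (finite `G`-sets with
the same fixed-point counts have isomorphic rational permutation modules).  The binder pair `(ψ, hψ)`
of `StableLatticeReductionInvariantInt` at universe `0`, as in the permutation-lattice files.

Source: Tate's computation of the global Euler–Poincaré characteristic at a totally complex field
(Milne, *Arithmetic Duality Theorems*, I §5, proof of Thm. 5.1, p. 70; Cassels–Fröhlich VII §8.3):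
the archimedean term is the class of the permutation module on the infinite places `S_∞(E)` of the
layer `E/F₀`, a FREE `Gal(E/F₀)`-set with `r₂(F₀)` orbits when `F₀` is totally complex (tree
`InfinitePlaceTotallyComplexBase`: `stabilizer_infinitePlace_eq_bot`, `card_infinitePlace_eq_mul`), whence
`[𝔽_p[S_∞(E)]] = r₂(F₀) · [𝔽_p[Gal(E/F₀)]]` — the multiple of the regular class in Tate's value.

## What is formalised (`G` a finite group, `p` a prime)

* `natCard_fixedBy_eq_zero_of_free` — on a free `G`-set a non-trivial element fixes nothing;
  `natCard_fixedBy_mul_self_eq_zero` — the same for `G` acting on itself;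
* **`additive_reduction_ofMulAction_of_free`** — `X` free with `#X = n · #G`:
  `ψ(ℤ[X]/p) = n • ψ(ℤ[G]/p)` (`G` acting on itself by left multiplication; Gassmann data
  `#Fix_g = 0` for `g ≠ 1` on both `X` and `Σ _ : Fin n, G`).

Written for lane «TATE-EPC-TC» of cell `bsd-eis` (road memo = evidence #54 on
stmt-BirchSwinnertonDyer-19032; lane state #60), brick B8-arith FILE C (the term
`nrComplexPlaces F₀ • ψ(𝔽_p[Δ])`).

## References
* J. S. Milne, *Arithmetic Duality Theorems*, 2nd ed. (2006), I §5, proof of Thm. 5.1 (p. 70). [MilneADT2006]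
* J. W. S. Cassels, A. Fröhlich (eds.), *Algebraic Number Theory* (1967), Ch. VII (Tate) §8.3.
  [CasselsFrohlichANT1967]
* J.-P. Serre, *Linear Representations of Finite Groups*, GTM 42 (1977), §15.2 Thm. 32; §13.1 Ex. 13.4.
  [SerreLinearRepresentations1977]
-/

namespace Literature.RepresentationTheory.FiniteGroups

namespace PermutationLattice

open Function LinearMap Submodule StableLatticeReduction MulAction
open scoped Pointwise

variable {G : Type} [Group G] {A : Type*} [AddCommGroup A] {p : ℕ}

/-! ### §1. Fixed points of a free action -/

/-- On a free `G`-set, an element `g ≠ 1` has no fixed point. [cite: SerreLinearRepresentations1977, §13.1 Ex. 13.4] -/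
theorem natCard_fixedBy_eq_zero_of_free {X : Type*} [MulAction G X]
    (hfree : ∀ x : X, stabilizer G x = ⊥) {g : G} (hg : g ≠ 1) :
    Nat.card (fixedBy X g) = 0 := by
  haveI : IsEmpty (fixedBy X g) := ⟨fun ⟨x, hx⟩ => by
    have hmem : g ∈ stabilizer G x := mem_stabilizer_iff.2 hx
    rw [hfree x, Subgroup.mem_bot] at hmem
    exact hg hmem⟩
  exact Nat.card_of_isEmpty

/-- `G` acting on itself by left multiplication: `g ≠ 1` fixes nothing.
[cite: SerreLinearRepresentations1977, §13.1 Ex. 13.4] -/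
theorem natCard_fixedBy_mul_self_eq_zero {g : G} (hg : g ≠ 1) : Nat.card (fixedBy G g) = 0 := by
  refine natCard_fixedBy_eq_zero_of_free (fun x => (Subgroup.eq_bot_iff_forall _).2 fun h hh => ?_) hg
  rw [mem_stabilizer_iff, smul_eq_mul] at hh
  exact mul_eq_right.1 hh

section Additive

variable (ψ : ∀ ⦃Y : Type⦄ [AddCommGroup Y] [Module ℤ Y], Representation ℤ G Y → A)
  (hψ : ∀ ⦃X Y Z : Type⦄ [AddCommGroup X] [Module ℤ X] [AddCommGroup Y] [Module ℤ Y]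
    [AddCommGroup Z] [Module ℤ Z] (ρX : Representation ℤ G X) (ρY : Representation ℤ G Y)
    (ρZ : Representation ℤ G Z) (f : X →ₗ[ℤ] Y) (g : Y →ₗ[ℤ] Z),
    (∀ s x, f (ρX s x) = ρY s (f x)) → (∀ s y, g (ρY s y) = ρZ s (g y)) →
    Injective f → Surjective g → LinearMap.range f = LinearMap.ker g → Finite Y →
    (∀ y : Y, (p : ℤ) • y = 0) → ψ ρY = ψ ρX + ψ ρZ)
include hψ

/-! ### §2. The free `G`-set with `n` orbits -/

/-- **`ψ(ℤ[X]/p) = n • ψ(ℤ[G]/p)` for a free finite `G`-set `X` with `#X = n · #G`.**  The `G`-sets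
`X` and `Σ _ : Fin n, G` (left multiplication) have the same fixed-point counts (`#X = n#G` for
`g = 1`, `0` otherwise), so `ℚ[X] ≅ ℚ[Σ _ : Fin n, G]` (`GassmannEquivalentPermutationModules`), hence
`ψ(ℤ[X]/p) = ψ(ℤ[Σ _ : Fin n, G]/p)` (`additive_reduction_ofMulAction_eq_of_ratEquiv`)
`= ∑_{Fin n} ψ(ℤ[G]/p)` (`additive_reduction_ofMulAction_sigma`).
[cite: MilneADT2006, I §5, proof of Thm. 5.1 (p. 70)] [cite: CasselsFrohlichANT1967, Ch. VII §8.3]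
[cite: SerreLinearRepresentations1977, §15.2 Thm. 32] -/
theorem additive_reduction_ofMulAction_of_free [Fintype G] [hp : Fact p.Prime] {X : Type} [Fintype X]
    [MulAction G X] (hfree : ∀ x : X, stabilizer G x = ⊥) (n : ℕ)
    (hcard : Fintype.card X = n * Fintype.card G) :
    ψ ((Representation.ofMulAction ℤ G X).quotient ((p : ℤ) • ⊤)
        (smul_top_le_comap (Representation.ofMulAction ℤ G X) (p : ℤ))) =
      n • ψ ((Representation.ofMulAction ℤ G G).quotient ((p : ℤ) • ⊤)
        (smul_top_le_comap (Representation.ofMulAction ℤ G G) (p : ℤ))) := by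
  classical
  -- Gassmann data: equal fixed-point counts on `X` and on `Σ _ : Fin n, G`
  have hfix : ∀ g : G, Nat.card (fixedBy X g) = Nat.card (fixedBy (Σ _ : Fin n, G) g) := by
    intro g
    by_cases hg : g = 1
    · subst hg
      rw [fixedBy_one_eq_univ, fixedBy_one_eq_univ, Nat.card_univ, Nat.card_univ,
        Nat.card_eq_fintype_card, Nat.card_eq_fintype_card, Fintype.card_sigma, Finset.sum_const,
        Finset.card_univ, Fintype.card_fin, smul_eq_mul, hcard]
    · rw [natCard_fixedBy_eq_zero_of_free hfree hg,
        ArtinGassmann.natCard_fixedBy_sigma (fun _ : Fin n => G) g, Finset.sum_eq_zero]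
      intro i _
      exact natCard_fixedBy_mul_self_eq_zero hg
  obtain ⟨e⟩ := (nonempty_equiv_ofMulAction_iff_forall_natCard_fixedBy_eq_field
    (X := X) (Y := Σ _ : Fin n, G) ℚ).2 hfix
  rw [additive_reduction_ofMulAction_eq_of_ratEquiv ψ hψ e,
    additive_reduction_ofMulAction_sigma ψ hψ (fun _ : Fin n => G), Finset.sum_const, Finset.card_univ,
    Fintype.card_fin]

end Additive

end PermutationLattice

end Literature.RepresentationTheory.FiniteGroups
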